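import Summits.QuantumFields.YangMills.Theorems.UnitScaleTiltProp7Taylor3Action
import HarnessLib

/-!
# Route `UnitScaleTilt`, crux K1 child «MinimiserStabilityRegPr» (stmt-QuantumFields-19200) — THE SCALE-AWARE TAYLOR ROW OF THE (α)-CURRENCY GROWTH KNIT:
# `A(e^{iD}W) − A(W) − ℓ_W(D) ≥ (1−θ)/2·Σ_p‖ℒ_p(D)‖² − (C₁s²/θ + C₂a)·Σ_b‖D(b)‖²` ([Balaban1985Variational] (142): the quadratic form dominates, remainder SECOND order in
# the sup radius)

Cell `ym3-torus`, width seat `ym-ust-19200-w4` (gen 4; follows the seat's LOCATED correction 2026-08-28 to its own `PV3ESigma.stub_PV3E_of_chartRowsSigma`).  THEOREMS ONLY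
(0 `def`, 0 `sorry`).  YM₃ on T³ is a ladder rung (R3), not the Clay problem; nothing here claims the stub, the crux, d = 4 or the mass gap.

WHY (numbers).  T3W (`Prop7Taylor3Word.abs_wilsonAction4_expChart_sub_taylor2_le`) bounds the third-order remainder of `D ↦ A(e^{iD}W)` by `4800·s·Σ_b‖D(b)‖²`, LINEAR in the
sup radius `s`; a chart competitor of (6)(e) has `s ≈ ε·ℓ⁻¹` (`ℓ = L^{K−n}`, [Balaban1985Variational] (19): `|A| < ε₂`, `D = ηA`) while the slice gap is `≈ κ₀·ℓ⁻²`, so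
`4800s ≤ κ` fails by a power of `ℓ`.  The loss is the estimate `‖ℒ_p‖ ≤ 4s` inside the cross term `⟨ℒ_p, x_p − ℒ_p⟩`: keeping `‖ℒ_p‖` and splitting
`2‖ℒ_p‖·‖r_p‖ ≤ θ‖ℒ_p‖² + θ⁻¹‖r_p‖²` (`‖r_p‖ ≤ (9/2)σ_p²`, `σ_p = Σ_{b∈∂p}‖D(b)‖ ≤ 4s`) makes the remainder `∝ s²σ_p² ∼ ε²ℓ⁻²·Σ‖D‖²` — the same power of `ℓ`
as the gap.  No `q_W`: the quadratic form enters only through `Σ_p‖ℒ_p(D)‖²` (the linearised relative plaquette variable), against which HESS_W is the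
slice Poincaré inequality `κ₀ℓ⁻²·Σ_b‖D(b)‖² ≤ Σ_p‖ℒ_p(D)‖²` ([Balaban1985BackgroundPropagators] Thm 3.11–3.12 at the critical background).

WHAT IS PROVED (ns `…Theorems.Prop7Taylor3Uniform`).  §1 `sq_norm_add_ge` (`(1−θ)‖L‖² − θ⁻¹‖r‖² ≤ ‖L + r‖²`), ★ `plaq_action_sub_lin_ge` (per plaquette, abstract:
unitary `P₀` with `‖P₀ − 1‖ ≤ a`, `‖Q‖ ≤ ½σ²`, `‖x − L − Q‖ ≤ 4σ³`, `σ ≤ 1` ⟹ `(1−θ)/2‖L‖² − ((81/8)θ⁻¹σ⁴ + (9/2)aσ²) ≤ ½‖x‖² + ½Re Tr((P₀−1)^*xP₀) − ½Re Tr((P₀−1)^*LP₀)`).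
§2 ★★ `wilsonAction4_expChart_sub_lin_ge` — for `D` Hermitian-traceless with `‖D(b)‖ ≤ s`, `4s ≤ 1`, plaquettes of `W` within `a ≥ 0` of `1`, `0 < θ ≤ 1`:
`(1−θ)/2·Σ_p‖ℒ_p(D)‖² − (7776θ⁻¹s² + 216a)·Σ_b‖D(b)‖² ≤ A(e^{iD}W) − A(W) − ℓ_W(D)` (`ℓ_W`, `ℒ_p` = T3W's letters VERBATIM; exact expansion
`Prop7ExactExpansion.wilsonAction4_sub_eq_relPlaq`, T3W §5 `norm_relPlaq_expChart_sub_lin_sub_quad_le`, incidence `4d = 12`).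

HONEST SCOPE.  Elementary bookkeeping over T3W; nothing of print asserted; `--supports stmt-QuantumFields-19200`, count-neutral.

References: T. Bałaban, CMP 102 (1985) 277–309 [Balaban1985Variational] ((19) p.281, (22)–(31) pp.281–283, (112) p.294, (141)–(142) p.299).
-/

set_option autoImplicit false
noncomputable section

open scoped BigOperators Matrix.Norms.L2Operator Matrix

namespace Summit.QuantumFields.YangMills.Theorems.Prop7Taylor3Uniform

open NormedSpace
open Literature.MathematicalPhysics.QuantumFieldTheory.Balaban1983to89
open Literature.MathematicalPhysics.QuantumFieldTheory.Balaban1983to89.T3ContinuumYM3Torus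
open Literature.MathematicalPhysics.QuantumFieldTheory.Balaban1983to89.T3SectALandauChart (emb15)
open Summit.QuantumFields.YangMills.Theorems.Prop7TPrint (expHerm coe_expHerm expHermField expHermField_apply)
open Summit.QuantumFields.YangMills.Theorems.Prop7Taylor3ExpChart (norm_I_smul)
open Summit.QuantumFields.YangMills.Theorems.PerturbedPlaquette (norm_conj_SU)
open Summit.QuantumFields.YangMills.Theorems.Prop7ExactExpansion (wilsonAction4_sub_eq_relPlaq abs_half_re_trace_sub_le)
open Summit.QuantumFields.YangMills.Theorems.Prop7FlatLocalMin (sum_plaq_bonds_le)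
open Summit.QuantumFields.YangMills.Theorems.Prop7Taylor3Word (norm_relPlaq_expChart_sub_lin_sub_quad_le norm_quad_le cube_sum_le)

/-! ## §1 Per plaquette, abstractly -/

/-- `(1−θ)‖L‖² − θ⁻¹‖r‖² ≤ ‖L + r‖²` for `0 < θ ≤ 1` (any seminormed group). [folklore] -/
theorem sq_norm_add_ge {E : Type*} [SeminormedAddCommGroup E] (L r : E) {θ : ℝ} (hθ : 0 < θ) (hθ1 : θ ≤ 1) :
    (1 - θ) * ‖L‖ ^ 2 - θ⁻¹ * ‖r‖ ^ 2 ≤ ‖L + r‖ ^ 2 := by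
  have hL : ‖L‖ ≤ ‖L + r‖ + ‖r‖ := by
    have := norm_sub_le (L + r) r
    rwa [add_sub_cancel_right] at this
  have h0 : 0 ≤ ‖L + r‖ := norm_nonneg _
  have hr0 : 0 ≤ ‖r‖ := norm_nonneg _
  have hL0 : 0 ≤ ‖L‖ := norm_nonneg _
  have hθi : 0 < θ⁻¹ := inv_pos.mpr hθ
  -- AM–GM: `2‖L‖‖r‖ ≤ θ‖L‖² + θ⁻¹‖r‖²`
  have hamgm : 2 * ‖L‖ * ‖r‖ ≤ θ * ‖L‖ ^ 2 + θ⁻¹ * ‖r‖ ^ 2 := by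
    have hsq : 0 ≤ (θ * ‖L‖ - ‖r‖) ^ 2 := sq_nonneg _
    have hkey : θ * (2 * ‖L‖ * ‖r‖) ≤ θ * (θ * ‖L‖ ^ 2 + θ⁻¹ * ‖r‖ ^ 2) := by
      have : θ * (θ * ‖L‖ ^ 2 + θ⁻¹ * ‖r‖ ^ 2) = (θ * ‖L‖) ^ 2 + ‖r‖ ^ 2 := by
        rw [mul_add, ← mul_assoc θ θ⁻¹, mul_inv_cancel₀ hθ.ne', one_mul]; ring
      rw [this]; nlinarith [hsq]
    exact le_of_mul_le_mul_left hkey hθ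
  by_cases hcase : ‖r‖ ≤ ‖L‖
  · have h1 : ‖L‖ - ‖r‖ ≤ ‖L + r‖ := by linarith
    have h2 : (‖L‖ - ‖r‖) ^ 2 ≤ ‖L + r‖ ^ 2 := pow_le_pow_left₀ (by linarith) h1 2
    nlinarith [h2, hamgm]
  · rw [not_le] at hcase
    have h3 : (1 - θ) * ‖L‖ ^ 2 ≤ (1 - θ) * ‖r‖ ^ 2 := mul_le_mul_of_nonneg_left (pow_le_pow_left₀ hL0 hcase.le 2) (by linarith)
    have h4 : (1 - θ) * ‖r‖ ^ 2 ≤ θ⁻¹ * ‖r‖ ^ 2 := by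
      have : 1 - θ ≤ θ⁻¹ := by
        have h1θ : (1 : ℝ) ≤ θ⁻¹ := one_le_inv_iff₀.mpr ⟨hθ, hθ1⟩
        linarith
      exact mul_le_mul_of_nonneg_right this (sq_nonneg _)
    nlinarith [h3, h4, sq_nonneg ‖L + r‖]

/-- ★ **THE ACTION-LEVEL GROWTH PER PLAQUETTE, SCALE-AWARE**: for unitary `P₀ ∈ M₂(ℂ)` with `‖P₀ − 1‖ ≤ a` and letters `x` (relative plaquette variable minus `1`),
`L` (linear part), `Q` (quadratic part, `‖Q‖ ≤ ½σ²`) with `‖x − L − Q‖ ≤ 4σ³`, `σ ≤ 1`, `0 < θ ≤ 1`: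
`(1−θ)/2·‖L‖² − ((81/8)θ⁻¹σ⁴ + (9/2)aσ²) ≤ ½‖x‖² + ½Re Tr((P₀−1)^* x P₀) − ½Re Tr((P₀−1)^* L P₀)`. [cite: Balaban1985Variational, (26)-(31) pp.282-283, (142) p.299] -/
theorem plaq_action_sub_lin_ge (P₀ x L Q : Matrix (Fin 2) (Fin 2) ℂ) (hP : P₀ ∈ Matrix.unitaryGroup (Fin 2) ℂ) {σ a θ : ℝ} (hσ1 : σ ≤ 1)
    (hθ : 0 < θ) (hθ1 : θ ≤ 1) (ha : ‖P₀ - 1‖ ≤ a) (hQ : ‖Q‖ ≤ (1 / 2) * σ ^ 2) (hR : ‖x - L - Q‖ ≤ 4 * σ ^ 3) :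
    (1 - θ) / 2 * ‖L‖ ^ 2 - ((81 / 8) * θ⁻¹ * σ ^ 4 + (9 / 2) * a * σ ^ 2)
      ≤ (1 / 2) * ‖x‖ ^ 2 + (1 / 2) * (((P₀ - 1)ᴴ * (x * P₀)).trace).re - (1 / 2) * (((P₀ - 1)ᴴ * (L * P₀)).trace).re := by
  -- the remainder `r = x − L`, `‖r‖ ≤ ½σ² + 4σ³ ≤ (9/2)σ²`
  have s32 : σ ^ 3 ≤ σ ^ 2 := by nlinarith [sq_nonneg σ, hσ1]
  have hxL : ‖x - L‖ ≤ (9 / 2) * σ ^ 2 := by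
    have hx : x - L = Q + (x - L - Q) := by abel
    rw [hx]
    exact (norm_add_le _ _).trans (by linarith [add_le_add hQ hR])
  -- `½‖x‖² ≥ (1−θ)/2‖L‖² − ‖r‖²/(2θ)`
  have hsq := sq_norm_add_ge L (x - L) hθ hθ1
  rw [add_sub_cancel] at hsq
  have hr2 : ‖x - L‖ ^ 2 ≤ ((9 / 2) * σ ^ 2) ^ 2 := pow_le_pow_left₀ (norm_nonneg _) hxL 2
  have hθi : 0 ≤ θ⁻¹ := inv_nonneg.mpr hθ.le
  have h1 : θ⁻¹ * ‖x - L‖ ^ 2 ≤ θ⁻¹ * ((9 / 2) * σ ^ 2) ^ 2 := mul_le_mul_of_nonneg_left hr2 hθi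
  -- the pairing `½Re Tr((P₀−1)^*(x − L)P₀) ≥ −a·(9/2)σ²`
  have hpair := abs_half_re_trace_sub_le P₀ x L hP
  have ha0 : 0 ≤ a := (norm_nonneg _).trans ha
  have h2 : ‖P₀ - 1‖ * ‖x - L‖ ≤ a * ((9 / 2) * σ ^ 2) := mul_le_mul ha hxL (norm_nonneg _) ha0
  have h3 := (abs_le.mp (hpair.trans h2)).1
  nlinarith [hsq, h1, h3]

/-! ## §2 On the lattice: the scale-aware Taylor row -/

variable {F : T3Family} {K : ℕ}

set_option maxHeartbeats 400000 in
/-- ★★ **THE SCALE-AWARE TAYLOR ROW FOR THE EXPONENTIAL CHART AT A BACKGROUND.**  For `W` with every plaquette variable within `a` of `1`, `D` Hermitian traceless with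
`‖D(b)‖ ≤ s` on every bond, `4s ≤ 1`, and `0 < θ ≤ 1`:
`(1−θ)/2·Σ_p‖ℒ_p(D)‖² − (7776·θ⁻¹·s² + 216·a)·Σ_b‖D(b)‖² ≤ A(e^{iD}W) − A(W) − ℓ_W(D)`,
with T3W's letters `ℓ_W(D) = Σ_p ½Re Tr((W(∂p) − 1)^*·ℒ_p·W(∂p))` and `ℒ_p = Z₁ + Z₂ − Z₃ − Z₄` (`Z_i` the transported `iD(b_i)`).  The remainder is SECOND order in the
sup radius (the cross term `⟨ℒ_p, r_p⟩` split as `θ‖ℒ_p‖² + θ⁻¹‖r_p‖²`), so that with `s ∼ εℓ⁻¹`, `a ∼ eℓ⁻²` every term scales like the slice gap `κ₀ℓ⁻²`.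
[cite: Balaban1985Variational, (141)-(142) p.299, (26)-(31) pp.282-283, (112) p.294] -/
theorem wilsonAction4_expChart_sub_lin_ge (W : GaugeField (F.P K) 0 (Matrix.specialUnitaryGroup (Fin 2) ℂ)) (D : PBond (F.P K) 0 → Matrix (Fin 2) (Fin 2) ℂ)
    (hD : ∀ b : PBond (F.P K) 0, (D b).IsHermitian ∧ Matrix.trace (D b) = 0) {s : ℝ} (hs : ∀ b : PBond (F.P K) 0, ‖D b‖ ≤ s)
    (hs4 : 4 * s ≤ 1) {a : ℝ} (ha0 : 0 ≤ a) (ha : ∀ p : Plaq (F.P K) 0, ‖((GaugeField.plaqHol W p : Matrix.specialUnitaryGroup (Fin 2) ℂ) : Matrix (Fin 2) (Fin 2) ℂ) - 1‖ ≤ a)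
    {θ : ℝ} (hθ : 0 < θ) (hθ1 : θ ≤ 1) :
    (1 - θ) / 2 * ∑ p : Plaq (F.P K) 0, ‖((Complex.I • D ⟨p.src, p.μ⟩) + ((W ⟨p.src, p.μ⟩ : Matrix (Fin 2) (Fin 2) ℂ) * (Complex.I • D ⟨p.src.shift p.μ, p.ν⟩) * star (W ⟨p.src, p.μ⟩ : Matrix (Fin 2) (Fin 2) ℂ))
            - (((W ⟨p.src, p.μ⟩ * W ⟨p.src.shift p.μ, p.ν⟩ * (W ⟨p.src.shift p.ν, p.μ⟩)⁻¹ : Matrix.specialUnitaryGroup (Fin 2) ℂ) : Matrix (Fin 2) (Fin 2) ℂ) * (Complex.I • D ⟨p.src.shift p.ν, p.μ⟩) * star ((W ⟨p.src, p.μ⟩ * W ⟨p.src.shift p.μ, p.ν⟩ * (W ⟨p.src.shift p.ν, p.μ⟩)⁻¹ : Matrix.specialUnitaryGroup (Fin 2) ℂ) : Matrix (Fin 2) (Fin 2) ℂ))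
            - (((GaugeField.plaqHol W p : Matrix.specialUnitaryGroup (Fin 2) ℂ) : Matrix (Fin 2) (Fin 2) ℂ) * (Complex.I • D ⟨p.src, p.ν⟩) * star ((GaugeField.plaqHol W p : Matrix.specialUnitaryGroup (Fin 2) ℂ) : Matrix (Fin 2) (Fin 2) ℂ)))‖ ^ 2
        - (7776 * θ⁻¹ * s ^ 2 + 216 * a) * ∑ b : PBond (F.P K) 0, ‖D b‖ ^ 2
      ≤ wilsonAction4 (emb15 W (expHermField D)) - wilsonAction4 W
        - ∑ p : Plaq (F.P K) 0, (1 / 2) * (((((GaugeField.plaqHol W p : Matrix.specialUnitaryGroup (Fin 2) ℂ) : Matrix (Fin 2) (Fin 2) ℂ) - 1)ᴴ * (((Complex.I • D ⟨p.src, p.μ⟩) + ((W ⟨p.src, p.μ⟩ : Matrix (Fin 2) (Fin 2) ℂ) * (Complex.I • D ⟨p.src.shift p.μ, p.ν⟩) * star (W ⟨p.src, p.μ⟩ : Matrix (Fin 2) (Fin 2) ℂ))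
            - (((W ⟨p.src, p.μ⟩ * W ⟨p.src.shift p.μ, p.ν⟩ * (W ⟨p.src.shift p.ν, p.μ⟩)⁻¹ : Matrix.specialUnitaryGroup (Fin 2) ℂ) : Matrix (Fin 2) (Fin 2) ℂ) * (Complex.I • D ⟨p.src.shift p.ν, p.μ⟩) * star ((W ⟨p.src, p.μ⟩ * W ⟨p.src.shift p.μ, p.ν⟩ * (W ⟨p.src.shift p.ν, p.μ⟩)⁻¹ : Matrix.specialUnitaryGroup (Fin 2) ℂ) : Matrix (Fin 2) (Fin 2) ℂ))
            - (((GaugeField.plaqHol W p : Matrix.specialUnitaryGroup (Fin 2) ℂ) : Matrix (Fin 2) (Fin 2) ℂ) * (Complex.I • D ⟨p.src, p.ν⟩) * star ((GaugeField.plaqHol W p : Matrix.specialUnitaryGroup (Fin 2) ℂ) : Matrix (Fin 2) (Fin 2) ℂ))) * ((GaugeField.plaqHol W p : Matrix.specialUnitaryGroup (Fin 2) ℂ) : Matrix (Fin 2) (Fin 2) ℂ))).trace).re := by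
  have h1 : ∀ b : PBond (F.P K) 0, ‖D b‖ ≤ 1 := fun b => (hs b).trans (by linarith)
  rw [wilsonAction4_sub_eq_relPlaq (emb15 W (expHermField D)) W, ← Finset.sum_sub_distrib]
  -- per plaquette
  have hper : ∀ p : Plaq (F.P K) 0,
      (1 - θ) / 2 * ‖((Complex.I • D ⟨p.src, p.μ⟩) + ((W ⟨p.src, p.μ⟩ : Matrix (Fin 2) (Fin 2) ℂ) * (Complex.I • D ⟨p.src.shift p.μ, p.ν⟩) * star (W ⟨p.src, p.μ⟩ : Matrix (Fin 2) (Fin 2) ℂ))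
            - (((W ⟨p.src, p.μ⟩ * W ⟨p.src.shift p.μ, p.ν⟩ * (W ⟨p.src.shift p.ν, p.μ⟩)⁻¹ : Matrix.specialUnitaryGroup (Fin 2) ℂ) : Matrix (Fin 2) (Fin 2) ℂ) * (Complex.I • D ⟨p.src.shift p.ν, p.μ⟩) * star ((W ⟨p.src, p.μ⟩ * W ⟨p.src.shift p.μ, p.ν⟩ * (W ⟨p.src.shift p.ν, p.μ⟩)⁻¹ : Matrix.specialUnitaryGroup (Fin 2) ℂ) : Matrix (Fin 2) (Fin 2) ℂ))
            - (((GaugeField.plaqHol W p : Matrix.specialUnitaryGroup (Fin 2) ℂ) : Matrix (Fin 2) (Fin 2) ℂ) * (Complex.I • D ⟨p.src, p.ν⟩) * star ((GaugeField.plaqHol W p : Matrix.specialUnitaryGroup (Fin 2) ℂ) : Matrix (Fin 2) (Fin 2) ℂ)))‖ ^ 2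
          - (648 * θ⁻¹ * s ^ 2 + 18 * a) * (‖D ⟨p.src, p.μ⟩‖ ^ 2 + ‖D ⟨p.src.shift p.μ, p.ν⟩‖ ^ 2 + ‖D ⟨p.src.shift p.ν, p.μ⟩‖ ^ 2 + ‖D ⟨p.src, p.ν⟩‖ ^ 2)
        ≤ ((1 / 2) * ‖(((GaugeField.plaqHol (emb15 W (expHermField D)) p : Matrix.specialUnitaryGroup (Fin 2) ℂ) : Matrix (Fin 2) (Fin 2) ℂ) * star ((GaugeField.plaqHol W p : Matrix.specialUnitaryGroup (Fin 2) ℂ) : Matrix (Fin 2) (Fin 2) ℂ) - 1)‖ ^ 2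
            + (1 / 2) * ((((((GaugeField.plaqHol W p : Matrix.specialUnitaryGroup (Fin 2) ℂ) : Matrix (Fin 2) (Fin 2) ℂ)) - 1)ᴴ
              * ((((GaugeField.plaqHol (emb15 W (expHermField D)) p : Matrix.specialUnitaryGroup (Fin 2) ℂ) : Matrix (Fin 2) (Fin 2) ℂ) * star ((GaugeField.plaqHol W p : Matrix.specialUnitaryGroup (Fin 2) ℂ) : Matrix (Fin 2) (Fin 2) ℂ) - 1)
                * ((GaugeField.plaqHol W p : Matrix.specialUnitaryGroup (Fin 2) ℂ) : Matrix (Fin 2) (Fin 2) ℂ))).trace).re)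
          - (1 / 2) * (((((GaugeField.plaqHol W p : Matrix.specialUnitaryGroup (Fin 2) ℂ) : Matrix (Fin 2) (Fin 2) ℂ) - 1)ᴴ * (((Complex.I • D ⟨p.src, p.μ⟩) + ((W ⟨p.src, p.μ⟩ : Matrix (Fin 2) (Fin 2) ℂ) * (Complex.I • D ⟨p.src.shift p.μ, p.ν⟩) * star (W ⟨p.src, p.μ⟩ : Matrix (Fin 2) (Fin 2) ℂ))
            - (((W ⟨p.src, p.μ⟩ * W ⟨p.src.shift p.μ, p.ν⟩ * (W ⟨p.src.shift p.ν, p.μ⟩)⁻¹ : Matrix.specialUnitaryGroup (Fin 2) ℂ) : Matrix (Fin 2) (Fin 2) ℂ) * (Complex.I • D ⟨p.src.shift p.ν, p.μ⟩) * star ((W ⟨p.src, p.μ⟩ * W ⟨p.src.shift p.μ, p.ν⟩ * (W ⟨p.src.shift p.ν, p.μ⟩)⁻¹ : Matrix.specialUnitaryGroup (Fin 2) ℂ) : Matrix (Fin 2) (Fin 2) ℂ))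
            - (((GaugeField.plaqHol W p : Matrix.specialUnitaryGroup (Fin 2) ℂ) : Matrix (Fin 2) (Fin 2) ℂ) * (Complex.I • D ⟨p.src, p.ν⟩) * star ((GaugeField.plaqHol W p : Matrix.specialUnitaryGroup (Fin 2) ℂ) : Matrix (Fin 2) (Fin 2) ℂ))) * ((GaugeField.plaqHol W p : Matrix.specialUnitaryGroup (Fin 2) ℂ) : Matrix (Fin 2) (Fin 2) ℂ))).trace).re := by
    intro p
    have n₁ : ‖(Complex.I • D ⟨p.src, p.μ⟩)‖ ≤ ‖D ⟨p.src, p.μ⟩‖ := (norm_I_smul _).le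
    have n₂ : ‖((W ⟨p.src, p.μ⟩ : Matrix (Fin 2) (Fin 2) ℂ) * (Complex.I • D ⟨p.src.shift p.μ, p.ν⟩) * star (W ⟨p.src, p.μ⟩ : Matrix (Fin 2) (Fin 2) ℂ))‖ ≤ ‖D ⟨p.src.shift p.μ, p.ν⟩‖ := by
      rw [norm_conj_SU, norm_I_smul]
    have n₃ : ‖(((W ⟨p.src, p.μ⟩ * W ⟨p.src.shift p.μ, p.ν⟩ * (W ⟨p.src.shift p.ν, p.μ⟩)⁻¹ : Matrix.specialUnitaryGroup (Fin 2) ℂ) : Matrix (Fin 2) (Fin 2) ℂ) * (Complex.I • D ⟨p.src.shift p.ν, p.μ⟩) * star ((W ⟨p.src, p.μ⟩ * W ⟨p.src.shift p.μ, p.ν⟩ * (W ⟨p.src.shift p.ν, p.μ⟩)⁻¹ : Matrix.specialUnitaryGroup (Fin 2) ℂ) : Matrix (Fin 2) (Fin 2) ℂ))‖ ≤ ‖D ⟨p.src.shift p.ν, p.μ⟩‖ := by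
      rw [norm_conj_SU, norm_I_smul]
    have n₄ : ‖(((GaugeField.plaqHol W p : Matrix.specialUnitaryGroup (Fin 2) ℂ) : Matrix (Fin 2) (Fin 2) ℂ) * (Complex.I • D ⟨p.src, p.ν⟩) * star ((GaugeField.plaqHol W p : Matrix.specialUnitaryGroup (Fin 2) ℂ) : Matrix (Fin 2) (Fin 2) ℂ))‖ ≤ ‖D ⟨p.src, p.ν⟩‖ := by
      rw [norm_conj_SU, norm_I_smul]
    have hQ := norm_quad_le _ _ _ _ (norm_nonneg _) (norm_nonneg _) (norm_nonneg _) (norm_nonneg _) n₁ n₂ n₃ n₄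
    have hR := norm_relPlaq_expChart_sub_lin_sub_quad_le W D p hD h1
    set σ : ℝ := ‖D ⟨p.src, p.μ⟩‖ + ‖D ⟨p.src.shift p.μ, p.ν⟩‖ + ‖D ⟨p.src.shift p.ν, p.μ⟩‖ + ‖D ⟨p.src, p.ν⟩‖ with hσdef
    have hσ0 : 0 ≤ σ := by positivity
    have hσ4 : σ ≤ 4 * s := by
      have := hs ⟨p.src, p.μ⟩; have := hs ⟨p.src.shift p.μ, p.ν⟩; have := hs ⟨p.src.shift p.ν, p.μ⟩; have := hs ⟨p.src, p.ν⟩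
      linarith
    have hσ1 : σ ≤ 1 := hσ4.trans hs4
    have hmain := plaq_action_sub_lin_ge ((GaugeField.plaqHol W p : Matrix.specialUnitaryGroup (Fin 2) ℂ) : Matrix (Fin 2) (Fin 2) ℂ) _ _ _ (GaugeField.plaqHol W p).2.1 hσ1 hθ hθ1 (ha p) hQ hR
    -- `σ⁴ ≤ 64 s²·Σe²`, `σ² ≤ 4·Σe²`
    have hcs : σ ^ 2 ≤ 4 * (‖D ⟨p.src, p.μ⟩‖ ^ 2 + ‖D ⟨p.src.shift p.μ, p.ν⟩‖ ^ 2 + ‖D ⟨p.src.shift p.ν, p.μ⟩‖ ^ 2 + ‖D ⟨p.src, p.ν⟩‖ ^ 2) := by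
      rw [hσdef]
      nlinarith [sq_nonneg (‖D ⟨p.src, p.μ⟩‖ - ‖D ⟨p.src.shift p.μ, p.ν⟩‖), sq_nonneg (‖D ⟨p.src, p.μ⟩‖ - ‖D ⟨p.src.shift p.ν, p.μ⟩‖),
        sq_nonneg (‖D ⟨p.src, p.μ⟩‖ - ‖D ⟨p.src, p.ν⟩‖), sq_nonneg (‖D ⟨p.src.shift p.μ, p.ν⟩‖ - ‖D ⟨p.src.shift p.ν, p.μ⟩‖),
        sq_nonneg (‖D ⟨p.src.shift p.μ, p.ν⟩‖ - ‖D ⟨p.src, p.ν⟩‖), sq_nonneg (‖D ⟨p.src.shift p.ν, p.μ⟩‖ - ‖D ⟨p.src, p.ν⟩‖)]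
    have hσ4' : σ ^ 4 ≤ 64 * s ^ 2 * (‖D ⟨p.src, p.μ⟩‖ ^ 2 + ‖D ⟨p.src.shift p.μ, p.ν⟩‖ ^ 2 + ‖D ⟨p.src.shift p.ν, p.μ⟩‖ ^ 2 + ‖D ⟨p.src, p.ν⟩‖ ^ 2) := by
      have hσsq : σ ^ 2 ≤ (4 * s) ^ 2 := pow_le_pow_left₀ hσ0 hσ4 2
      calc σ ^ 4 = σ ^ 2 * σ ^ 2 := by ring
        _ ≤ (4 * s) ^ 2 * (4 * (‖D ⟨p.src, p.μ⟩‖ ^ 2 + ‖D ⟨p.src.shift p.μ, p.ν⟩‖ ^ 2 + ‖D ⟨p.src.shift p.ν, p.μ⟩‖ ^ 2 + ‖D ⟨p.src, p.ν⟩‖ ^ 2)) :=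
            mul_le_mul hσsq hcs (sq_nonneg _) (sq_nonneg _)
        _ = 64 * s ^ 2 * (‖D ⟨p.src, p.μ⟩‖ ^ 2 + ‖D ⟨p.src.shift p.μ, p.ν⟩‖ ^ 2 + ‖D ⟨p.src.shift p.ν, p.μ⟩‖ ^ 2 + ‖D ⟨p.src, p.ν⟩‖ ^ 2) := by ring
    have hθi : 0 ≤ θ⁻¹ := inv_nonneg.mpr hθ.le
    have e1 : (81 / 8) * θ⁻¹ * σ ^ 4 ≤ (81 / 8) * θ⁻¹ * (64 * s ^ 2 * (‖D ⟨p.src, p.μ⟩‖ ^ 2 + ‖D ⟨p.src.shift p.μ, p.ν⟩‖ ^ 2 + ‖D ⟨p.src.shift p.ν, p.μ⟩‖ ^ 2 + ‖D ⟨p.src, p.ν⟩‖ ^ 2)) :=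
      mul_le_mul_of_nonneg_left hσ4' (by positivity)
    have e2 : (9 / 2) * a * σ ^ 2 ≤ (9 / 2) * a * (4 * (‖D ⟨p.src, p.μ⟩‖ ^ 2 + ‖D ⟨p.src.shift p.μ, p.ν⟩‖ ^ 2 + ‖D ⟨p.src.shift p.ν, p.μ⟩‖ ^ 2 + ‖D ⟨p.src, p.ν⟩‖ ^ 2)) :=
      mul_le_mul_of_nonneg_left hcs (by positivity)
    linarith [hmain, e1, e2]
  -- sum over plaquettes + incidence
  have hsum := Finset.sum_le_sum fun p (_ : p ∈ Finset.univ) => hper p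
  rw [Finset.sum_sub_distrib, ← Finset.mul_sum, ← Finset.mul_sum] at hsum
  have hinc := sum_plaq_bonds_le (P := F.P K) (j := 0) (fun b => ‖D b‖ ^ 2) (fun b => sq_nonneg _)
  have hd : ((F.P K).d : ℝ) = 3 := by norm_num [T3Family.P_d]
  rw [hd] at hinc
  have hθi : 0 ≤ θ⁻¹ := inv_nonneg.mpr hθ.le
  have hcoef : 0 ≤ 648 * θ⁻¹ * s ^ 2 + 18 * a := by positivity
  have e3 := mul_le_mul_of_nonneg_left hinc hcoef
  linarith [hsum, e3]

end Summit.QuantumFields.YangMills.Theorems.Prop7Taylor3Uniform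

end
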